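import Mathlib
import Literature.Computability.AlgebraicComplexity.PermanentIrreducible
import Literature.Computability.AlgebraicComplexity.LandsbergRessayreNormalForm

/-!
# Crux `GrenetZeon.TwoDimCoefficients` (stmt-ValiantsHypothesis-8062), line `dim2_cases` —
# units modulo the permanent: a polynomial zero-free on `Z(per_n)` is `c + per_n · q`

Helper for the registered stub `stub_unitDichotomy` (first half of its sketch, the ALGEBRAIC half;
the second half — a Hessian point — is a separate matter, see the crux workfile `UNIT-CASE-NOTE.md`).

* `dvd_homogeneousComponent_mul` — if `P` is homogeneous, `P` divides every homogeneous component of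
  `P * w`.
* `homogeneousComponent_mul_totalDegree` — in `K[x]` the top homogeneous components multiply:
  `(f g)_{deg f + deg g} = f_{deg f} · g_{deg g}`.
* `totalDegree_sub_homogeneousComponent_lt` — removing the top component lowers the total degree.
* `dvd_sub_C_of_dvd_mul_sub_one` — **units of the graded domain `K[x]/(P)` are constants**: if `P` is a
  homogeneous prime of positive degree and `P ∣ v f − 1`, then `P ∣ f − f(0)` (descent on
  `deg f + deg v`: the top component of `v f − 1` in positive degree is `v_top f_top` and is divisible
  by `P`, so `P` divides one of the tops, which is then removed).
* `exists_eq_C_add_perPoly_mul` — **Nullstellensatz form for the permanent**: a polynomial `f` over `ℂ`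
  with no zero on the permanental hypersurface `Z(per_n)` (`n ≥ 1`) is `f = C c + per_n · q` with
  `c = f(0) ≠ 0` (Hilbert's Nullstellensatz, Mathlib `MvPolynomial.vanishingIdeal_zeroLocus_eq_radical`,
  gives `u·per_n + v·f = 1`; `per_n` is a homogeneous prime by the tree's `perPoly_irreducible`).

HONEST FRAMING: commutative-algebra plumbing for an ASIDE item; nothing here bears on `VP ≠ VNP`.

References: D. Eisenbud, *Commutative Algebra with a View Toward Algebraic Geometry*, GTM 150,
Thm. 1.6 (Nullstellensatz) and §1.5 (graded rings); the irreducibility of the permanent is the tree's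
`Literature.Computability.AlgebraicComplexity.perPoly_irreducible`.
-/

-- single-conjunct layout `Summits/ValiantsHypothesis/ValiantsHypothesis`: the duplicated namespace
-- component is mandated by the tree.
set_option linter.dupNamespace false

noncomputable section

open MvPolynomial

namespace Summit.ValiantsHypothesis.ValiantsHypothesis.Theorems.GrenetZeonTwoDimCoefficients

/-! ### Homogeneous components: three elementary lemmas -/

section Components

variable {σ : Type*} {K : Type*} [Field K]

/-- A homogeneous `P` divides every homogeneous component of a multiple `P * w`. [folklore] -/
theorem dvd_homogeneousComponent_mul {P : MvPolynomial σ K} {N : ℕ} (hP : P.IsHomogeneous N)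
    (w : MvPolynomial σ K) (m : ℕ) : P ∣ homogeneousComponent m (P * w) := by
  classical
  conv_rhs => rw [← sum_homogeneousComponent w]
  rw [Finset.mul_sum, map_sum]
  refine Finset.dvd_sum fun i _ => ?_
  rw [homogeneousComponent_of_mem (hP.mul (homogeneousComponent_isHomogeneous i w))]
  split_ifs
  · exact dvd_mul_right _ _
  · exact dvd_zero _

/-- If `P` is homogeneous and `P ∣ p`, then `P` divides every homogeneous component of `p`.
[folklore] -/
theorem dvd_homogeneousComponent_of_dvd {P p : MvPolynomial σ K} {N : ℕ} (hP : P.IsHomogeneous N)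
    (h : P ∣ p) (m : ℕ) : P ∣ homogeneousComponent m p := by
  obtain ⟨w, rfl⟩ := h
  exact dvd_homogeneousComponent_mul hP w m

/-- Top homogeneous components multiply: `(f g)_{deg f + deg g} = f_{deg f} · g_{deg g}`.
[folklore] -/
theorem homogeneousComponent_mul_totalDegree (f g : MvPolynomial σ K) :
    homogeneousComponent (f.totalDegree + g.totalDegree) (f * g) =
      homogeneousComponent f.totalDegree f * homogeneousComponent g.totalDegree g := by
  classical
  ext d
  rw [coeff_homogeneousComponent, coeff_mul, coeff_mul]
  split_ifs with hd
  · refine Finset.sum_congr rfl fun x hx => ?_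
    rw [Finset.HasAntidiagonal.mem_antidiagonal] at hx
    rw [coeff_homogeneousComponent, coeff_homogeneousComponent]
    have hdeg : x.1.degree + x.2.degree = f.totalDegree + g.totalDegree := by
      rw [← map_add, hx, hd]
    by_cases h1 : x.1.degree = f.totalDegree
    · have h2 : x.2.degree = g.totalDegree := by omega
      rw [if_pos h1, if_pos h2]
    · rw [if_neg h1]
      rcases Nat.lt_or_gt_of_ne h1 with hlt | hgt
      · have h2 : g.totalDegree < x.2.degree := by omega
        have hg0 : coeff x.2 g = 0 :=
          coeff_eq_zero_of_totalDegree_lt (by rw [← Finsupp.degree_apply]; exact h2)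
        rw [hg0, mul_zero, zero_mul]
      · have hf0 : coeff x.1 f = 0 :=
          coeff_eq_zero_of_totalDegree_lt (by rw [← Finsupp.degree_apply]; exact hgt)
        rw [hf0, zero_mul, zero_mul]
  · symm
    refine Finset.sum_eq_zero fun x hx => ?_
    rw [Finset.HasAntidiagonal.mem_antidiagonal] at hx
    rw [coeff_homogeneousComponent, coeff_homogeneousComponent]
    split_ifs with h1 h2
    · exfalso
      apply hd
      rw [← hx, map_add, h1, h2]
    · rw [mul_zero]
    · rw [zero_mul]
    · rw [zero_mul]

/-- Removing the top homogeneous component lowers the total degree (when it is positive).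
[folklore] -/
theorem totalDegree_sub_homogeneousComponent_lt {f : MvPolynomial σ K} (h : 0 < f.totalDegree) :
    (f - homogeneousComponent f.totalDegree f).totalDegree < f.totalDegree := by
  classical
  rw [totalDegree, Finset.sup_lt_iff (lt_of_le_of_lt (Nat.zero_le _) h)]
  intro d hd
  have hd' := mem_support_iff.mp hd
  rw [coeff_sub, coeff_homogeneousComponent] at hd'
  split_ifs at hd' with hdeg
  · exact absurd (sub_self _) hd'
  · rw [sub_zero] at hd'
    have hle : (d.sum fun _ e => e) ≤ f.totalDegree := le_totalDegree (mem_support_iff.mpr hd')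
    have hne : (d.sum fun _ e => e) ≠ f.totalDegree := fun h' => hdeg (by
      rw [Finsupp.degree_apply]; exact h')
    omega

end Components

/-! ### Units of the graded domain `K[x]/(P)` are constants -/

section GradedUnit

variable {σ : Type*} {K : Type*} [Field K]

/-- **Units modulo a homogeneous prime are constants.**  If `P` is a homogeneous prime in `K[x]`
(necessarily of positive degree) and `P ∣ v f − 1`, then `P ∣ f − f(0)`.  (Descent on `deg f + deg v`.) [folklore] -/
theorem dvd_sub_C_of_dvd_mul_sub_one {P : MvPolynomial σ K} {N : ℕ} (hP : P.IsHomogeneous N)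
    (hprime : Prime P) :
    ∀ (S : ℕ) (f v : MvPolynomial σ K), f.totalDegree + v.totalDegree ≤ S → P ∣ v * f - 1 →
      P ∣ f - C (coeff 0 f) := by
  classical
  -- a constant `f` is trivially fine
  have hconst : ∀ f : MvPolynomial σ K, f.totalDegree = 0 → P ∣ f - C (coeff 0 f) := by
    intro f hf
    rw [totalDegree_eq_zero_iff_eq_C] at hf
    rw [← hf, sub_self]
    exact dvd_zero _
  -- `P` divides no non-zero constant
  have hPC : ∀ a : K, P ∣ C a → a = 0 := by
    intro a ha
    by_contra h0
    exact hprime.not_unit (isUnit_of_dvd_unit ha ((isUnit_iff_ne_zero.mpr h0).map C))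
  intro S
  induction S with
  | zero =>
      intro f v hS _
      exact hconst f (by omega)
  | succ S ih =>
      intro f v hS h
      by_cases hD : f.totalDegree = 0
      · exact hconst f hD
      set D := f.totalDegree with hDdef
      set E := v.totalDegree with hEdef
      -- `P` divides the top component `v_E f_D` of `v f - 1`
      have htop : P ∣ homogeneousComponent E v * homogeneousComponent D f := by
        rw [hEdef, hDdef, ← homogeneousComponent_mul_totalDegree v f]
        have h1 := dvd_homogeneousComponent_of_dvd hP h (v.totalDegree + f.totalDegree)
        rwa [map_sub, homogeneousComponent_of_mem (isHomogeneous_one (σ := σ) (R := K)),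
          if_neg (by omega), sub_zero] at h1
      rcases hprime.dvd_or_dvd htop with hv | hf
      · -- `P ∣ v_E`: `E = 0` is impossible, else remove `v_E`
        by_cases hE : E = 0
        · exfalso
          have hvC : v = C (coeff 0 v) := by
            rw [← totalDegree_eq_zero_iff_eq_C]; exact hE
          rw [hE, homogeneousComponent_zero] at hv
          have hv0 : coeff 0 v = 0 := hPC _ hv
          rw [hvC, hv0, C_0, zero_mul, zero_sub] at h
          exact one_ne_zero (hPC 1 (by rwa [C_1, ← dvd_neg]))
        · have hlt := totalDegree_sub_homogeneousComponent_lt (f := v) (by omega)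
          refine ih f (v - homogeneousComponent E v) (by rw [← hEdef] at hlt; omega) ?_
          have : (v - homogeneousComponent E v) * f - 1 =
              (v * f - 1) - homogeneousComponent E v * f := by ring
          rw [this]
          exact dvd_sub h (dvd_mul_of_dvd_left hv f)
      · -- `P ∣ f_D`: remove `f_D` (the constant coefficient is unchanged since `D ≠ 0`)
        have hlt := totalDegree_sub_homogeneousComponent_lt (f := f) (by omega)
        have hrec := ih (f - homogeneousComponent D f) v (by rw [← hDdef] at hlt; omega) (by
          have : v * (f - homogeneousComponent D f) - 1 =
              (v * f - 1) - v * homogeneousComponent D f := by ring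
          rw [this]
          exact dvd_sub h (dvd_mul_of_dvd_right hf v))
        have hc0 : coeff 0 (f - homogeneousComponent D f) = coeff 0 f := by
          rw [coeff_sub, coeff_homogeneousComponent, if_neg, sub_zero]
          rw [map_zero]
          exact fun h0 => hD h0.symm
        rw [hc0] at hrec
        have : f - C (coeff 0 f) = (f - homogeneousComponent D f - C (coeff 0 f)) +
            homogeneousComponent D f := by ring
        rw [this]
        exact dvd_add hrec hf

/-- Packaged form: if `u * P + v * f = 1` for a homogeneous prime `P`, then
`f = C (f 0) + P * q` for some `q`, and `f 0 ≠ 0`. [folklore] -/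
theorem exists_eq_C_add_mul_of_isUnit_mod {P : MvPolynomial σ K} {N : ℕ} (hP : P.IsHomogeneous N)
    (hprime : Prime P) {f u v : MvPolynomial σ K} (h : u * P + v * f = 1) :
    coeff 0 f ≠ 0 ∧ ∃ q : MvPolynomial σ K, f = C (coeff 0 f) + P * q := by
  have hdvd : P ∣ v * f - 1 := ⟨-u, by rw [← h]; ring⟩
  obtain ⟨q, hq⟩ := dvd_sub_C_of_dvd_mul_sub_one hP hprime _ f v le_rfl hdvd
  refine ⟨fun h0 => ?_, q, by rw [← hq]; ring⟩
  -- if `f(0) = 0` then `P ∣ f`, so `P ∣ v f - (v f - 1) = 1`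
  rw [h0, C_0, sub_zero] at hq
  have h1 : P ∣ (1 : MvPolynomial σ K) := by
    have : (1 : MvPolynomial σ K) = v * f - (v * f - 1) := by ring
    rw [this]
    exact dvd_sub (hq ▸ dvd_mul_of_dvd_right (dvd_mul_right P q) v) hdvd
  exact hprime.not_unit (isUnit_of_dvd_one h1)

end GradedUnit

/-! ### The permanent: Nullstellensatz + graded units -/

section Permanent

open Literature.Computability.AlgebraicComplexity

/-- **A polynomial with no zero on the permanental hypersurface is a non-zero constant modulo
`per_n`.**  For `n ≥ 1` and `f ∈ ℂ[x_{ij}]` with `f(p) ≠ 0` whenever `per_n(p) = 0`: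
`f = C c + per_n · q` with `c = f(0) ≠ 0`.  (Nullstellensatz: `Z(per_n, f) = ∅` gives
`u per_n + v f = 1`; then `dvd_sub_C_of_dvd_mul_sub_one` for the homogeneous prime `per_n`.) [folklore] -/
theorem exists_eq_C_add_perPoly_mul {n : ℕ} (hn : 1 ≤ n) (f : MvPolynomial (Fin n × Fin n) ℂ)
    (hf : ∀ p : Fin n × Fin n → ℂ, eval p (perPoly (Fin n) ℂ) = 0 → eval p f ≠ 0) :
    ∃ (c : ℂ) (q : MvPolynomial (Fin n × Fin n) ℂ), c ≠ 0 ∧ f = C c + perPoly (Fin n) ℂ * q := by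
  classical
  -- Nullstellensatz: the ideal `(per_n, f)` has empty zero locus, hence is everything
  set J : Ideal (MvPolynomial (Fin n × Fin n) ℂ) := Ideal.span {perPoly (Fin n) ℂ, f} with hJ
  have hVJ : zeroLocus ℂ J = ∅ := by
    refine Set.eq_empty_iff_forall_notMem.2 fun p hp => ?_
    rw [hJ, zeroLocus_span] at hp
    have h1 : aeval p (perPoly (Fin n) ℂ) = 0 := hp _ (Set.mem_insert _ _)
    have h2 : aeval p f = 0 := hp _ (Set.mem_insert_of_mem _ (Set.mem_singleton _))
    have h1' : eval p (perPoly (Fin n) ℂ) = 0 := h1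
    have h2' : eval p f = 0 := h2
    exact hf p h1' h2'
  have hJtop : J = ⊤ := by
    rw [← Ideal.radical_eq_top, ← vanishingIdeal_zeroLocus_eq_radical (K := ℂ) J, hVJ]
    exact vanishingIdeal_empty
  have h1 : (1 : MvPolynomial (Fin n × Fin n) ℂ) ∈ J := by rw [hJtop]; exact Submodule.mem_top
  rw [hJ, Ideal.mem_span_pair] at h1
  obtain ⟨u, v, huv⟩ := h1
  -- `per_n` is a homogeneous prime of degree `n ≥ 1`
  haveI : Nonempty (Fin n) := ⟨⟨0, hn⟩⟩
  have hprime : Prime (perPoly (Fin n) ℂ) := (perPoly_irreducible (n := Fin n) (R := ℂ)).prime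
  have hhom : (perPoly (Fin n) ℂ).IsHomogeneous n := by
    simpa only [Fintype.card_fin] using (perPoly_isHomogeneous : (perPoly (Fin n) ℂ).IsHomogeneous _)
  obtain ⟨hc, q, hq⟩ := exists_eq_C_add_mul_of_isUnit_mod hhom hprime huv
  exact ⟨coeff 0 f, q, hc, hq⟩

end Permanent

end Summit.ValiantsHypothesis.ValiantsHypothesis.Theorems.GrenetZeonTwoDimCoefficients

end
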